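import Literature.NumberTheory.LFunctions.WeilMarkovQuadratic
import Literature.NumberTheory.LFunctions.WeilWindowSuzukiProofs
import Literature.NumberTheory.LFunctions.WeilWindowSuzukiAsymptoticProofs
import Mathlib.Analysis.SpecialFunctions.Integrals.Basic
import Mathlib.Analysis.SpecialFunctions.ImproperIntegrals
import Mathlib.MeasureTheory.Function.SpecialFunctions.Basic

/-!
# Auxiliary lemmas for stub `stub_surplusReduction`
(line `borderline-barrier`, crux `WeilWindowFlow.WindowLipschitz`)

One-variable infrastructure for the three-piece lower bound of the archimedean jump operator
`(L B)(y) = ∫₀^∞ (2B(y) − B(y+t) − B(y−t)) ρ(t) dt`, `ρ = weilArchDensity`, applied to the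
two-scale barrier `B(x) = W(min(a − |x|, d₀))`, `W(s) = (log(1/s))^{-1/2}`:

* the profile `W`: positivity of `log(1/s)` on `(0,1)`, monotonicity, measurability, and the
  purely algebraic Lipschitz estimate `W(s₂) − W(s₁) ≤ (s₂ − s₁)/(2 s₁ L √L)` for
  `0 < L ≤ log(1/s₂)` (from `1/√v − 1/√u = (u − v)/(√u √v (√u + √v))` and
  `u − v = log(s₂/s₁) ≤ s₂/s₁ − 1`; no derivatives are used);
* the density `ρ`: `1/(2t) − 1 ≤ ρ(t) ≤ 1/(2t) + 1` on `(0,1]` (`abs_weilArchDensity_sub_le`),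
  `ρ(t) ≤ 1/t` on `(0, 1/2]`, `ρ(t) ≤ (3/2) e^{-t/2}` on `[1,∞)` (`weilArchDensity_eq_inv`),
  hence `∫_{(1,∞)} ρ ≤ 3e^{-1/2} ≤ 2`, the tail bound `∫_{(x,∞)} ρ ≤ ½ log(1/x) + 3` and the
  killing bound `½ log(1/x) − 1 ≤ ∫_{(x,∞)} ρ` for `0 < x ≤ 1`;
* a generic integrability criterion on `(0,∞)`: bounded on `(0, δ]`, dominated by `M ρ` on
  `(δ, ∞)`;
* the two-scale barrier `B` (entering as the hypothesis
  `hB : ∀ x, B x = if |x| < a then 1/√(log(1/min (a − |x|) d₀)) else 0`): its values at the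
  layer point `a − d` and at `a − d ± t`, the bounds `0 ≤ B ≤ β₀ = W(d₀)`, evenness and
  measurability; integrability of the model integrand `(W(d+s) − W(d))/(2s)` of `J` on
  `(0, d₀ − d]`.

All statements are elementary real analysis ([folklore]); the constants are crude.
-/

set_option linter.dupNamespace false

noncomputable section

open MeasureTheory Set Filter
open scoped Topology ENNReal NNReal

namespace Summit.RiemannHypothesis.RiemannHypothesis.Theorems.WeilWindowFlowWindowLipschitz

open Literature.NumberTheory.LFunctions

/-! ## The profile `W(s) = (log(1/s))^{-1/2}` -/

/-- `0 < log(1/s)` for `0 < s < 1`. [folklore] -/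
theorem stub_surplusReduction_log_pos {s : ℝ} (hs : 0 < s) (hs1 : s < 1) :
    0 < Real.log (1 / s) :=
  Real.log_pos (one_lt_one_div hs hs1)

/-- `W(s) = (log(1/s))^{-1/2}` is non-decreasing on `(0, 1)`. [folklore] -/
theorem stub_surplusReduction_W_mono {s₁ s₂ : ℝ} (h1 : 0 < s₁) (h12 : s₁ ≤ s₂) (h2 : s₂ < 1) :
    1 / Real.sqrt (Real.log (1 / s₁)) ≤ 1 / Real.sqrt (Real.log (1 / s₂)) := by
  have h2' : 0 < s₂ := h1.trans_le h12
  have hv : 0 < Real.log (1 / s₂) := stub_surplusReduction_log_pos h2' h2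
  refine one_div_le_one_div_of_le (Real.sqrt_pos.2 hv) (Real.sqrt_le_sqrt ?_)
  exact Real.log_le_log (by positivity) (one_div_le_one_div_of_le h1 h12)

/-- `s ↦ (log(1/s))^{-1/2}` is measurable. [folklore] -/
theorem stub_surplusReduction_W_measurable :
    Measurable fun s : ℝ ↦ 1 / Real.sqrt (Real.log (1 / s)) := by
  have h1 : Measurable fun s : ℝ ↦ Real.log (1 / s) := (measurable_const.div measurable_id).log
  exact measurable_const.div h1.sqrt

/-- **Algebraic Lipschitz estimate for `W(s) = (log(1/s))^{-1/2}`.** For `0 < s₁ ≤ s₂` and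
`0 < L ≤ log(1/s₂)` (so `s₂ < 1`): `W(s₂) − W(s₁) ≤ (s₂ − s₁)/(2 s₁ L √L)`. With
`u = log(1/s₁) ≥ v = log(1/s₂)`: `1/√v − 1/√u = (√u − √v)/(√u√v)`,
`(√u − √v)(√u + √v) = u − v = log(s₂/s₁) ≤ (s₂ − s₁)/s₁`, and
`√u√v(√u + √v) ≥ 2 v√v ≥ 2 L√L`. [folklore] -/
theorem stub_surplusReduction_W_lipschitz {s₁ s₂ L : ℝ} (h1 : 0 < s₁) (h12 : s₁ ≤ s₂)
    (hL : 0 < L) (hLs : L ≤ Real.log (1 / s₂)) :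
    1 / Real.sqrt (Real.log (1 / s₂)) - 1 / Real.sqrt (Real.log (1 / s₁)) ≤
      (s₂ - s₁) / (2 * s₁ * (L * Real.sqrt L)) := by
  have h2' : 0 < s₂ := h1.trans_le h12
  set u : ℝ := Real.log (1 / s₁) with hu
  set v : ℝ := Real.log (1 / s₂) with hv
  have hdiff : u - v ≤ (s₂ - s₁) / s₁ := by
    have e : u - v = Real.log (s₂ / s₁) := by
      rw [hu, hv, ← Real.log_div (by positivity) (by positivity)]
      congr 1
      field_simp
    have e2 : s₂ / s₁ - 1 = (s₂ - s₁) / s₁ := by field_simp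
    rw [e, ← e2]
    exact Real.log_le_sub_one_of_pos (by positivity)
  have hv0 : 0 < v := hL.trans_le hLs
  have huv : v ≤ u := by
    rw [hu, hv]
    exact Real.log_le_log (by positivity) (one_div_le_one_div_of_le h1 h12)
  have hu0 : 0 < u := hv0.trans_le huv
  have hq : 0 < Real.sqrt v := Real.sqrt_pos.2 hv0
  have hp : 0 < Real.sqrt u := Real.sqrt_pos.2 hu0
  have hqp : Real.sqrt v ≤ Real.sqrt u := Real.sqrt_le_sqrt huv
  have hLv : L * Real.sqrt L ≤ v * Real.sqrt v :=
    mul_le_mul hLs (Real.sqrt_le_sqrt hLs) (Real.sqrt_nonneg _) hv0.le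
  have hp2 : Real.sqrt u ^ 2 = u := Real.sq_sqrt hu0.le
  have hq2 : Real.sqrt v ^ 2 = v := Real.sq_sqrt hv0.le
  have hs : s₁ * (u - v) ≤ s₂ - s₁ := by
    have := (le_div_iff₀ h1).1 hdiff
    linarith [mul_comm s₁ (u - v)]
  have hkey : 2 * v ≤ (Real.sqrt u + Real.sqrt v) * Real.sqrt u := by
    nlinarith [mul_le_mul_of_nonneg_left hqp hq.le]
  rw [div_sub_div _ _ hq.ne' hp.ne', one_mul, mul_one,
    div_le_div_iff₀ (mul_pos hq hp) (by positivity)]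
  calc (Real.sqrt u - Real.sqrt v) * (2 * s₁ * (L * Real.sqrt L))
      ≤ (Real.sqrt u - Real.sqrt v) * (2 * s₁ * (v * Real.sqrt v)) := by
        apply mul_le_mul_of_nonneg_left _ (sub_nonneg.2 hqp)
        exact mul_le_mul_of_nonneg_left hLv (by positivity)
    _ = s₁ * (Real.sqrt u - Real.sqrt v) * Real.sqrt v * (2 * v) := by ring
    _ ≤ s₁ * (Real.sqrt u - Real.sqrt v) * Real.sqrt v *
          ((Real.sqrt u + Real.sqrt v) * Real.sqrt u) :=
        mul_le_mul_of_nonneg_left hkey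
          (mul_nonneg (mul_nonneg h1.le (sub_nonneg.2 hqp)) hq.le)
    _ = s₁ * (Real.sqrt u ^ 2 - Real.sqrt v ^ 2) * (Real.sqrt v * Real.sqrt u) := by ring
    _ = s₁ * (u - v) * (Real.sqrt v * Real.sqrt u) := by rw [hp2, hq2]
    _ ≤ (s₂ - s₁) * (Real.sqrt v * Real.sqrt u) :=
        mul_le_mul_of_nonneg_right hs (by positivity)

/-! ## The archimedean density `ρ` -/

/-- On `(0,1]`: `1/(2t) − 1 ≤ ρ(t) ≤ 1/(2t) + 1` (`abs_weilArchDensity_sub_le`). [folklore] -/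
theorem stub_surplusReduction_rho_bounds {t : ℝ} (ht0 : 0 < t) (ht1 : t ≤ 1) :
    1 / (2 * t) - 1 ≤ weilArchDensity t ∧ weilArchDensity t ≤ 1 / (2 * t) + 1 := by
  have h := abs_le.1 (abs_weilArchDensity_sub_le ht0 ht1)
  constructor <;> linarith [h.1, h.2]

/-- On `(0, 1/2]`: `ρ(t) ≤ 1/t`. [folklore] -/
theorem stub_surplusReduction_rho_le_inv {t : ℝ} (ht0 : 0 < t) (ht1 : t ≤ 1 / 2) :
    weilArchDensity t ≤ 1 / t := by
  have h := (stub_surplusReduction_rho_bounds ht0 (by linarith)).2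
  have h1 : (1 : ℝ) ≤ 1 / (2 * t) := by
    rw [le_div_iff₀ (by positivity)]
    linarith
  have h2 : 1 / (2 * t) = 1 / t / 2 := by ring
  linarith

/-- On `[1, ∞)`: `ρ(t) = 1/(e^{t/2} − e^{-3t/2}) ≤ (3/2) e^{-t/2}` (`3 e^{-3t/2} ≤ e^{t/2}` as
`e^{2t} ≥ e² ≥ 3`). [folklore] -/
theorem stub_surplusReduction_rho_le_exp {t : ℝ} (ht : 1 ≤ t) :
    weilArchDensity t ≤ 3 / 2 * Real.exp (-(1 / 2) * t) := by
  have ht0 : 0 < t := by linarith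
  have hden : 0 < Real.exp (t / 2) - Real.exp (-(3 * t / 2)) :=
    sub_pos.2 (Real.exp_lt_exp.2 (by linarith))
  have hA : Real.exp (-(1 / 2) * t) = (Real.exp (t / 2))⁻¹ := by
    rw [← Real.exp_neg]
    congr 1
    ring
  have h3 : 3 * Real.exp (-(3 * t / 2)) ≤ Real.exp (t / 2) := by
    have h2t : (3 : ℝ) ≤ Real.exp (2 * t) := by
      have := Real.add_one_le_exp (2 * t)
      linarith
    calc 3 * Real.exp (-(3 * t / 2)) ≤ Real.exp (2 * t) * Real.exp (-(3 * t / 2)) :=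
          mul_le_mul_of_nonneg_right h2t (Real.exp_pos _).le
      _ = Real.exp (t / 2) := by
          rw [← Real.exp_add]
          congr 1
          ring
  rw [weilArchDensity_eq_inv ht0, hA, inv_le_comm₀ hden (by positivity), mul_inv, inv_inv]
  have e : (3 / 2 : ℝ)⁻¹ = 2 / 3 := by norm_num
  rw [e]
  linarith

/-- `∫_{(1,∞)} ρ ≤ 3 e^{-1/2} ≤ 2`. [folklore] -/
theorem stub_surplusReduction_rho_integral_Ioi_one :
    ∫ t in Ioi (1 : ℝ), weilArchDensity t ≤ 2 := by
  have hi : IntegrableOn (fun t : ℝ ↦ 3 / 2 * Real.exp (-(1 / 2) * t)) (Ioi 1) :=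
    (integrableOn_exp_mul_Ioi (by norm_num) 1).const_mul (3 / 2)
  have hle : ∫ t in Ioi (1 : ℝ), weilArchDensity t ≤
      ∫ t in Ioi (1 : ℝ), 3 / 2 * Real.exp (-(1 / 2) * t) :=
    setIntegral_mono_on (integrableOn_weilArchDensity_Ioi one_pos) hi measurableSet_Ioi
      fun t ht ↦ stub_surplusReduction_rho_le_exp (le_of_lt ht)
  have hval : ∫ t in Ioi (1 : ℝ), 3 / 2 * Real.exp (-(1 / 2) * t) = 3 * Real.exp (-(1 / 2)) := by
    have h := integral_exp_mul_Ioi (show (-(1 / 2) : ℝ) < 0 by norm_num) 1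
    rw [mul_one] at h
    rw [integral_const_mul, h]
    ring
  have hexp : Real.exp (-(1 / 2)) ≤ 2 / 3 := by
    have h1 := Real.add_one_le_exp (1 / 2 : ℝ)
    have h2 : Real.exp (-(1 / 2)) * Real.exp (1 / 2) = 1 := by
      rw [← Real.exp_add]
      norm_num
    nlinarith [Real.exp_pos (-(1 / 2) : ℝ)]
  linarith

/-- `t ↦ t⁻¹` is interval integrable on `[x, 1]` for `0 < x ≤ 1`. [folklore] -/
theorem stub_surplusReduction_inv_intervalIntegrable {x : ℝ} (hx : 0 < x) (hx1 : x ≤ 1) :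
    IntervalIntegrable (fun t : ℝ ↦ t⁻¹) volume x 1 := by
  refine intervalIntegral.intervalIntegrable_inv (fun t ht ↦ ?_) continuousOn_id
  rw [Set.uIcc_of_le hx1] at ht
  exact (hx.trans_le ht.1).ne'

/-- `∫_x^1 (t⁻¹/2 + c) dt = ½ log(1/x) + (1 − x) c` for `0 < x ≤ 1`. [folklore] -/
theorem stub_surplusReduction_integral_model {x : ℝ} (hx : 0 < x) (hx1 : x ≤ 1) (c : ℝ) :
    ∫ t in x..1, (1 / 2 * t⁻¹ + c) = 1 / 2 * Real.log (1 / x) + (1 - x) * c := by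
  rw [intervalIntegral.integral_add
      ((stub_surplusReduction_inv_intervalIntegrable hx hx1).const_mul _) intervalIntegrable_const,
    intervalIntegral.integral_const_mul, integral_inv_of_pos hx one_pos,
    intervalIntegral.integral_const, smul_eq_mul]

/-- **Tail bound.** `∫_{(x,∞)} ρ ≤ ½ log(1/x) + 3` for `0 < x ≤ 1`
(`ρ ≤ 1/(2t) + 1` on `(x, 1]`, `∫_{(1,∞)} ρ ≤ 2`). [folklore] -/
theorem stub_surplusReduction_rho_tail {x : ℝ} (hx : 0 < x) (hx1 : x ≤ 1) :
    ∫ t in Ioi x, weilArchDensity t ≤ Real.log (1 / x) / 2 + 3 := by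
  have hρ : IntegrableOn weilArchDensity (Ioi x) := integrableOn_weilArchDensity_Ioi hx
  have hρ1 : IntegrableOn weilArchDensity (Ioc x 1) := hρ.mono_set Ioc_subset_Ioi_self
  have hsplit : ∫ t in Ioi x, weilArchDensity t =
      (∫ t in Ioc x 1, weilArchDensity t) + ∫ t in Ioi 1, weilArchDensity t := by
    rw [← Ioc_union_Ioi_eq_Ioi hx1, setIntegral_union Ioc_disjoint_Ioi_same measurableSet_Ioi
      hρ1 (hρ.mono_set (Ioi_subset_Ioi hx1))]
  have hmid : ∫ t in Ioc x 1, weilArchDensity t ≤ 1 / 2 * Real.log (1 / x) + (1 - x) * 1 := by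
    rw [← stub_surplusReduction_integral_model hx hx1 1, ← intervalIntegral.integral_of_le hx1]
    refine intervalIntegral.integral_mono_on hx1
      ((intervalIntegrable_iff_integrableOn_Ioc_of_le hx1).2 hρ1)
      (((stub_surplusReduction_inv_intervalIntegrable hx hx1).const_mul _).add
        intervalIntegrable_const) fun t ht ↦ ?_
    have h := (stub_surplusReduction_rho_bounds (hx.trans_le ht.1) ht.2).2
    have e : 1 / (2 * t) = 1 / 2 * t⁻¹ := by ring
    linarith
  have htail := stub_surplusReduction_rho_integral_Ioi_one
  linarith

/-- **Killing bound.** `½ log(1/x) − 1 ≤ ∫_{(x,∞)} ρ` for `0 < x ≤ 1`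
(`ρ ≥ 1/(2t) − 1` on `(x, 1]`, `ρ > 0`). [folklore] -/
theorem stub_surplusReduction_rho_killing {x : ℝ} (hx : 0 < x) (hx1 : x ≤ 1) :
    Real.log (1 / x) / 2 - 1 ≤ ∫ t in Ioi x, weilArchDensity t := by
  have hρ : IntegrableOn weilArchDensity (Ioi x) := integrableOn_weilArchDensity_Ioi hx
  have hρ1 : IntegrableOn weilArchDensity (Ioc x 1) := hρ.mono_set Ioc_subset_Ioi_self
  have h1 : ∫ t in Ioc x 1, weilArchDensity t ≤ ∫ t in Ioi x, weilArchDensity t :=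
    setIntegral_mono_set hρ (ae_restrict_of_forall_mem measurableSet_Ioi
      fun t ht ↦ (weilArchDensity_pos (hx.trans ht)).le) Ioc_subset_Ioi_self.eventuallyLE
  have h2 : 1 / 2 * Real.log (1 / x) + (1 - x) * (-1) ≤ ∫ t in Ioc x 1, weilArchDensity t := by
    rw [← stub_surplusReduction_integral_model hx hx1 (-1), ← intervalIntegral.integral_of_le hx1]
    refine intervalIntegral.integral_mono_on hx1
      (((stub_surplusReduction_inv_intervalIntegrable hx hx1).const_mul _).add
        intervalIntegrable_const)
      ((intervalIntegrable_iff_integrableOn_Ioc_of_le hx1).2 hρ1) fun t ht ↦ ?_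
    have h := (stub_surplusReduction_rho_bounds (hx.trans_le ht.1) ht.2).1
    have e : 1 / (2 * t) = 1 / 2 * t⁻¹ := by ring
    linarith
  linarith

/-! ## A generic integrability criterion on `(0, ∞)` -/

/-- A measurable `g` with `|g| ≤ C` on `(0, δ]` and `|g| ≤ M ρ` on `(δ, ∞)` (`δ > 0`) is integrable
on `(0, ∞)` (finite measure near `0`, `integrableOn_weilArchDensity_Ioi` away from `0`).
[folklore] -/
theorem stub_surplusReduction_integrableOn_of_bounds {g : ℝ → ℝ} (hg : Measurable g)
    {δ C M : ℝ} (hδ : 0 < δ) (h1 : ∀ t, 0 < t → t ≤ δ → |g t| ≤ C)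
    (h2 : ∀ t, δ < t → |g t| ≤ M * weilArchDensity t) : IntegrableOn g (Ioi 0) := by
  rw [← Ioc_union_Ioi_eq_Ioi hδ.le]
  refine IntegrableOn.union ?_ ?_
  · exact Measure.integrableOn_of_bounded measure_Ioc_lt_top.ne hg.aestronglyMeasurable
      (ae_restrict_of_forall_mem measurableSet_Ioc fun t ht ↦ by
        rw [Real.norm_eq_abs]
        exact h1 t ht.1 ht.2)
  · exact Integrable.mono' ((integrableOn_weilArchDensity_Ioi hδ).const_mul M)
      hg.aestronglyMeasurable
      (ae_restrict_of_forall_mem measurableSet_Ioi fun t ht ↦ by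
        rw [Real.norm_eq_abs]
        exact h2 t ht)

/-! ## Evaluations of the two-scale barrier and the model integrand of `J` -/

section Barrier

variable {a d₀ d : ℝ} {B : ℝ → ℝ}

/-- At the layer point `a − d`: `B(a − d) = W(d)`. [folklore] -/
theorem stub_surplusReduction_B_center
    (hB : ∀ x, B x = if |x| < a then 1 / Real.sqrt (Real.log (1 / min (a - |x|) d₀)) else 0)
    (hd : 0 < d) (hdd₀ : d < d₀) (hd₀a : d₀ < a) :
    B (a - d) = 1 / Real.sqrt (Real.log (1 / d)) := by
  have hx : |a - d| = a - d := abs_of_pos (by linarith)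
  have hm : min (a - (a - d)) d₀ = d := by
    rw [min_eq_left (by linarith)]
    ring
  rw [hB, hx, if_pos (by linarith), hm]

/-- Outward, inside the window: `B(a − d + t) = W(d − t)` for `0 ≤ t < d`. [folklore] -/
theorem stub_surplusReduction_B_out_near
    (hB : ∀ x, B x = if |x| < a then 1 / Real.sqrt (Real.log (1 / min (a - |x|) d₀)) else 0)
    (hdd₀ : d < d₀) (hd₀a : d₀ < a) {t : ℝ} (ht0 : 0 ≤ t) (htd : t < d) :
    B (a - d + t) = 1 / Real.sqrt (Real.log (1 / (d - t))) := by
  have hx : |a - d + t| = a - d + t := abs_of_pos (by linarith)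
  have hm : min (a - (a - d + t)) d₀ = d - t := by
    rw [min_eq_left (by linarith)]
    ring
  rw [hB, hx, if_pos (by linarith), hm]

/-- Outward, outside the window: `B(a − d + t) = 0` for `t ≥ d`. [folklore] -/
theorem stub_surplusReduction_B_out_far
    (hB : ∀ x, B x = if |x| < a then 1 / Real.sqrt (Real.log (1 / min (a - |x|) d₀)) else 0)
    {t : ℝ} (htd : d ≤ t) : B (a - d + t) = 0 := by
  rw [hB, if_neg]
  exact not_lt.2 (le_trans (by linarith) (le_abs_self (a - d + t)))

/-- Inward, in the layer: `B(a − d − t) = W(d + t)` for `0 ≤ t ≤ d₀ − d`. [folklore] -/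
theorem stub_surplusReduction_B_in_near
    (hB : ∀ x, B x = if |x| < a then 1 / Real.sqrt (Real.log (1 / min (a - |x|) d₀)) else 0)
    (hd : 0 < d) (hd₀a : d₀ < a) {t : ℝ} (ht0 : 0 ≤ t) (ht : t ≤ d₀ - d) :
    B (a - d - t) = 1 / Real.sqrt (Real.log (1 / (d + t))) := by
  have hx : |a - d - t| = a - d - t := abs_of_pos (by linarith)
  have hm : min (a - (a - d - t)) d₀ = d + t := by
    rw [min_eq_left (by linarith)]
    ring
  rw [hB, hx, if_pos (by linarith), hm]

/-- `0 ≤ B ≤ β₀ = W(d₀)` everywhere (on the window `min(a − |x|, d₀) ∈ (0, d₀]` and `W` is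
non-decreasing on `(0,1)`). [folklore] -/
theorem stub_surplusReduction_B_bounds
    (hB : ∀ x, B x = if |x| < a then 1 / Real.sqrt (Real.log (1 / min (a - |x|) d₀)) else 0)
    (hd₀ : 0 < d₀) (h2d₀ : 2 * d₀ ≤ 1) (x : ℝ) :
    0 ≤ B x ∧ B x ≤ 1 / Real.sqrt (Real.log (1 / d₀)) := by
  rw [hB]
  split_ifs with hx
  · have hm0 : 0 < min (a - |x|) d₀ := lt_min (by linarith) hd₀
    exact ⟨by positivity,
      stub_surplusReduction_W_mono hm0 (min_le_right _ _) (by linarith)⟩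
  · exact ⟨le_rfl, by positivity⟩

/-- The barrier is even. [folklore] -/
theorem stub_surplusReduction_B_even
    (hB : ∀ x, B x = if |x| < a then 1 / Real.sqrt (Real.log (1 / min (a - |x|) d₀)) else 0)
    (x : ℝ) : B (-x) = B x := by
  rw [hB (-x), hB x, abs_neg]

/-- The barrier is measurable. [folklore] -/
theorem stub_surplusReduction_B_measurable
    (hB : ∀ x, B x = if |x| < a then 1 / Real.sqrt (Real.log (1 / min (a - |x|) d₀)) else 0) :
    Measurable B := by
  have e : B = fun x ↦ if |x| < a then 1 / Real.sqrt (Real.log (1 / min (a - |x|) d₀)) else 0 :=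
    funext hB
  rw [e]
  refine Measurable.ite (measurableSet_lt continuous_abs.measurable measurable_const) ?_
    measurable_const
  exact stub_surplusReduction_W_measurable.comp
    ((measurable_const.sub continuous_abs.measurable).min measurable_const)

/-- The model integrand of `J`, `s ↦ (W(d + s) − W(d))/(2s)`, is integrable on `(0, d₀ − d]`
(non-negative and bounded by `1/(4 d L₀√L₀)` by the Lipschitz estimate). [folklore] -/
theorem stub_surplusReduction_J_integrable (hd : 0 < d) (hdd₀ : d < d₀) (h2d₀ : 2 * d₀ ≤ 1) :
    IntegrableOn (fun s ↦ (1 / Real.sqrt (Real.log (1 / (d + s))) -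
      1 / Real.sqrt (Real.log (1 / d))) / (2 * s)) (Ioc 0 (d₀ - d)) := by
  have hd₀ : 0 < d₀ := hd.trans hdd₀
  have hL₀ : 0 < Real.log (1 / d₀) := stub_surplusReduction_log_pos hd₀ (by linarith)
  set L₀ : ℝ := Real.log (1 / d₀) with hL₀def
  have hmeas : Measurable (fun s : ℝ ↦ (1 / Real.sqrt (Real.log (1 / (d + s))) -
      1 / Real.sqrt (Real.log (1 / d))) / (2 * s)) :=
    ((stub_surplusReduction_W_measurable.comp (measurable_const.add measurable_id)).sub
      measurable_const).div (measurable_const.mul measurable_id)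
  refine Measure.integrableOn_of_bounded measure_Ioc_lt_top.ne hmeas.aestronglyMeasurable
    (M := 1 / (4 * d * (L₀ * Real.sqrt L₀)))
    (ae_restrict_of_forall_mem measurableSet_Ioc fun t ht ↦ ?_)
  have ht0 : 0 < t := ht.1
  have hmono := stub_surplusReduction_W_mono (s₁ := d) (s₂ := d + t) hd (by linarith)
    (by linarith [ht.2])
  have hlip := stub_surplusReduction_W_lipschitz (s₁ := d) (s₂ := d + t) (L := L₀) hd
    (by linarith) hL₀ (Real.log_le_log (by positivity)
      (one_div_le_one_div_of_le (by positivity) (by linarith [ht.2])))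
  rw [add_sub_cancel_left] at hlip
  rw [Real.norm_eq_abs, abs_of_nonneg (div_nonneg (sub_nonneg.2 hmono) (by positivity))]
  calc _ ≤ t / (2 * d * (L₀ * Real.sqrt L₀)) / (2 * t) :=
        div_le_div_of_nonneg_right hlip (by positivity)
    _ = 1 / (4 * d * (L₀ * Real.sqrt L₀)) := by
        field_simp
        ring

end Barrier

end Summit.RiemannHypothesis.RiemannHypothesis.Theorems.WeilWindowFlowWindowLipschitz

end
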